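import Summits.BirchSwinnertonDyer.Rank1Residual.X10.MuZeroRoadThree
import Summits.BirchSwinnertonDyer.BirchSwinnertonDyer.Theorems.Rank1ResidualX10bMuTransfer
import Summits.BirchSwinnertonDyer.BirchSwinnertonDyer.Theorems.Rank1ResidualX10bMainConjecture
import HarnessLib

/-!
# Class X10b (N2: `p = 3` good ordinary, `E[3]` irreducible, `ρ̄_{E,3}` NOT surjective) — the
# `μ`-transfer at `3` on the `μ`-ZERO ROAD: `KatoMuTransferThree` ∧ one unit coefficient of `L_3(f, α)`
# IS Greenberg's `μ = 0` at the pair, so Kato's clause (2) becomes the INTEGRAL divisibility — the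
# Euler-system half in BOTH ranks and `BSD(E,3)` at the `3 ∤ #Ш_an` rank-`1` pairs, with NO rational
# main conjecture (no Yan–Zhu flag) and NO image hypothesis (cell `b2b-bsdres`, unit `b2b-bsdres-x10`
# = N2 class lead, GEN 35; TOOL — theorems only, no definition, no named fact, nothing booked)

HONEST FRAMING (run/shared/lean/b2b/bsd-rank1-residual/, verbatim in every file): the goal of the
cell is to DELETE the COMBINATION-SHAPED residual classes of the Birch–Swinnerton-Dyer formula for
ALL analytic-rank `≤ 1` elliptic curves over `ℚ` — "full BSD formula for every rank `≤ 1` curve in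
class `C`" assembled STRICTLY from published theorems — so that the rank-`≤ 1` remainder becomes
exactly the CONSTRUCTION-SHAPED classes, which are TYPED (missing-input `Prop`s), NOT attempted.
This is not "finishing BSD". Class X10b (N2) keeps its label CONSTRUCTION-SHAPED / NEEDS X_A3
(RESIDUAL-MAP §I N2); nothing is booked by this file; no census number moves.

## What (x10 GEN 35, X10-AUDIT §41; companion of `X10/MuTransferThreeBothRanks.lean`)

GEN 34 (`X10/MuZeroRoad.lean`, `X10/MuZeroRoadThree.lean`) proved: Greenberg's `μ(X(E/ℚ_∞)) = 0` AT
THE PAIR turns Kato's RATIONAL divisibility (Thm. 17.4 (2), printed for every image) into the INTEGRAL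
divisibility datum (`divisibility_of_kato_of_mu_eq_zero`), hence the Euler-system half at rank `0` and
`MazurMainConjecture W 3 ↔ BSDp W 3`. The cell `bsd-smallim` typed the `p = 3` `μ`-transfer
`KatoMuTransferThree` (KOLY-MEMO §5.7, 5.7.3 (ii); p407527): on X10b, one `3`-adic unit coefficient of
`L_3(f, α)` ⟹ `μ(X) = 0` for every cyclotomic datum (`x10b_mu_eq_zero_of_katoMuTransferThree`). THIS
FILE composes the two — the hypothesis `hμ` of GEN 34's road is DISCHARGED on X10b by
`KatoMuTransferThree` + the finite `μ^an = 0` certificate `hcertA` — and carries the same datum into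
the rank-`1` engine of x10 GEN 6 (`X10.missingUpperBoundAt_three_rankOne_of_divisibility`,
`X10.bsdp_three_rankOne_of_divisibility_of_shaAn_unit`, p195323), which until now had NO source for its
divisibility hypothesis `hdiv` on X10b ("Kato 13.4 (3) needs a rank-one-cokernel element"):

* `divisibility_three_of_katoMuTransferThree` — on X10b (any rank): Kato (2) (`hK`) ∧
  `KatoMuTransferThree` ∧ `hcertA` ∧ the period unit `h3` ⟹ the Néron-normalised INTEGRAL divisibility
  datum `hdiv` (`X` torsion, `g ∈ char_Λ X`, `ι g = ϖ · L_3(f, α)`) for every cyclotomic datum;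
* `missingUpperBoundAt_three_rankOne_of_katoMuTransferThree` — **N2 ∩ {r = 1}: the Euler-system half
  `ord₃ #Ш(E/ℚ) ≤ ord₃ #Ш(E/ℚ)_an`** modulo the Schneider certificate `hSch`, from PUBLISHED facts (Kato
  17.4 (2), Perrin-Riou–Schneider / Perrin-Riou 1987 / Mazur–Tate σ at odd `p`, modularity, GZK, `h3`)
  + `KatoMuTransferThree` + `hcertA` — NO rational main conjecture, no flag;
* `bsdp_three_rankOne_of_katoMuTransferThree_of_shaAn_unit` — **N2 ∩ {r = 1} at a pair with
  `ord₃ #Ш(E/ℚ)_an = 0`: Miller's `BSD(E,3)`** from the same + the census datum `hunit`;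
* `missingUpperBoundAt_three_rankZero_of_katoMuTransferThree`,
  `mazurMainConjecture_iff_bsdp_three_rankZero_of_katoMuTransferThree`,
  `mazurMainConjecture_three_rankZero_of_katoMuTransferThree_of_bsdp` — **N2 ∩ {r = 0}**: GEN 34's three
  conclusions with `hμ` discharged by `KatoMuTransferThree` + `hcertA`; the last one reads: at every
  rank-`0` N2 pair whose `BSD(E,3)` is booked by the lane's certificates, X_A3 AT THE PAIR
  (`MazurMainConjecture W 3`) ⟸ `KatoMuTransferThree` + the `μ^an = 0` certificate — flag-free;
* `missingUpperBoundAt_three_rankZero_of_katoMuTransferThree_anyImage`,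
  `mazurMainConjecture_iff_bsdp_three_rankZero_of_katoMuTransferThree_anyImage` — **ALL of class X10 ∩
  {r = 0}, EITHER image** (surjective: the good-ordinary tower + Kato (3), x10 GEN 5/13; otherwise §3):
  the Euler-system half and (X_A3 ⟺ `BSD(E,3)`) with NO image hypothesis.

READING for N2 (evidence, no label moves): with GEN 34 + this file, the flag-free per-pair residue of
X_A3 on the rank-`0` cells and of the Euler-system half on the rank-`1` cells is EXACTLY the open node
`KatoMuTransferThree` (+ finite certificates); the companion file `MuTransferThreeBothRanks` gives the
full `BSD(E,3)` in both ranks when the rational main conjecture at `3` (Yan–Zhu Thm. 4.9, flag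
`YZ26@3-BF-ERL-Ohta`) is admitted. Where `3` enters: only through `ClassX10`; Kato (2), the `μ`-road and
the rank-one engine are stated for odd `p`.

References: [Kato2004Asterisque] Thm. 17.4 (2) (p. 273), Thm. 12.6, 17.13; [GreenbergLNM1716] Conj.
1.11, Thm. 4.1; [GreenbergVatsal2000] (1)–(2), Prop. 3.7, §3 Remark (3.4); [PerrinRiou1987] §1.4
Cor. 1.8; [BalakrishnanMullerStein2015] Thm. 1.7; [Wuthrich2014] Prop. 21; [Miller2011LMS] Def. 1.1;
cell files X10-AUDIT.md §12, §40, §41; HOME/pub/bsd-smallim/koly/KOLY-MEMO.md §5.7.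
-/

set_option autoImplicit false

noncomputable section

open scoped Classical MatrixGroups ModularForm

open CongruenceSubgroup WeierstrassCurve Literature.NumberTheory.EllipticCurves
  Literature.NumberTheory.EllipticCurves.ModularForms Literature.NumberTheory.EllipticCurves.Rank1Residual
  Literature.NumberTheory.EllipticCurves.Rank1Residual.Typed
  Literature.NumberTheory.EllipticCurves.Wuthrich2014
  Summit.BirchSwinnertonDyer.BirchSwinnertonDyer.Theorems.Rank1ResidualX1Defs
  Summit.BirchSwinnertonDyer.BirchSwinnertonDyer.Rank1Residual

namespace Summit.BirchSwinnertonDyer.Rank1Residual.X10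

variable (W : WeierstrassCurve ℚ) [W.IsElliptic] [W.IsGloballyMinimal]

/-! ### §1. The integral divisibility datum on X10b from Kato (2) + the `μ`-transfer (any rank) -/

/-- **X10b, any rank: Kato Thm. 17.4 (2) ∧ `KatoMuTransferThree` ∧ one unit coefficient of `L_3(f, α)`
⟹ the Néron-normalised INTEGRAL divisibility datum at `(E,3)`** — for every cyclotomic `(κ, γ)`, the
newform `f` of `E` at level `N_E`, the period ratio `ϖ` (`ϖ · Ω_E = Ω⁺_f`) and every Pontryagin-dual
datum `D`: `X` is `Λ`-torsion and some `g ∈ char_Λ X` has `ι g = ϖ · L_3(f, α)` (the hypothesis `hdiv`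
of x10 GEN 6's rank-one engine). PUBLISHED binders: `kato_divisibility` (`hK`; only clause (2) is
used), the period unit at `3` (`h3`), modularity (`hmodP`, to run the certificate through a newform);
CELL input `KatoMuTransferThree` (open node); finite certificate `hcertA`. Proof: the transfer gives
`D.mu = 0` (`x10b_mu_eq_zero_of_katoMuTransferThree`), then GEN 34's
`divisibility_of_kato_of_mu_eq_zero` (`μ = 0` ⟹ `p ∤ f_E`, so the `p^n` of clause (2) divides the
cofactor); `ϖ ≠ 0` as `Ω⁺_f > 0`, `ord₃ ϖ = 0` by `padicValRat_periodRatio_eq_zero_three`.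
[cite: Kato2004Asterisque, Thm. 17.4 (2) (p. 273)] [cite: GreenbergVatsal2000, p. 2 (1)–(2), Prop. (3.7) and §3 Remark (3.4)] -/
theorem divisibility_three_of_katoMuTransferThree
    (hmodP : nonempty_modularParametrizationData) (h3 : realPeriodRat_eq_unit_mul_plusPeriod_three)
    (hT3 : KatoMuTransferThree)
    (hK : ∀ (κ : ZpExtension ℚ 3) (γ : Field.absoluteGaloisGroup ℚ) [NeZero (W.conductorNorm ℤ)]
      (f : CuspForm (Gamma0 (W.conductorNorm ℤ)) 2), kato_divisibility W 3 (κ := κ) (γ := γ) (f := f))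
    (hX : ClassX10 W 3) (hns : ¬ Surj W 3)
    (hcertA : ∀ {N : ℕ} [NeZero N] (f : CuspForm (Gamma0 N) 2), IsNewformOf W f →
      ∃ n : ℕ, ‖PowerSeries.coeff n (padicLFunction f (unitRoot W 3 : ℚ_[3]))‖ = 1) :
    ∀ (κ : ZpExtension ℚ 3) (γ : Field.absoluteGaloisGroup ℚ),
        κ.IsCyclotomic → κ.IsTopGenerator γ → IsCyclotomicVariable 3 γ →
      ∀ [NeZero (W.conductorNorm ℤ)] (f : CuspForm (Gamma0 (W.conductorNorm ℤ)) 2),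
        IsNewformOf W f → ∀ (ϖ : ℚ), (ϖ : ℝ) * W.realPeriodRat = plusPeriod f →
      ∀ (D : W.SelmerDualData κ γ), D.IsTorsion ∧
        ∃ g ∈ D.charIdeal, iwasawaToPowerSeries 3 g =
          PowerSeries.C (ϖ : ℚ_[3]) * padicLFunction f (unitRoot W 3 : ℚ_[3]) := by
  intro κ γ hκ hγ hγ' _ f hf ϖ hϖeq D
  have hμ := x10b_mu_eq_zero_of_katoMuTransferThree hmodP hT3 W 3 hX hns hcertA
  have hplus : plusPeriod f ≠ 0 := (IsNewform0.plusPeriod_pos_holds hf.1 hf.coeffField_eq_bot).ne'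
  have hϖ0 : ϖ ≠ 0 := by
    rintro rfl
    apply hplus
    rw [← hϖeq]
    simp
  exact divisibility_of_kato_of_mu_eq_zero W 3 (hK κ γ f) (by decide) hX.2.1.1 hX.2.1.2 hX.2.2.1 hκ hγ
    hγ' hf D (hμ κ γ hκ hγ hγ' D) ϖ hϖ0
    (padicValRat_periodRatio_eq_zero_three W h3 hX.2.1.1 hX.2.2.1 f hf ϖ hϖeq)

/-! ### §2. N2 ∩ {r = 1}: the Euler-system half and `BSD(E,3)` at the `3 ∤ #Ш_an` pairs — flag-free -/

/-- **N2 ∩ {r = 1}: `KatoMuTransferThree` ∧ certificate ⟹ the Euler-system half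
`ord₃ #Ш(E/ℚ) ≤ ord₃ #Ш(E/ℚ)_an`** (`Typed.MissingUpperBoundAt W 3`), modulo the Schneider certificate
`hSch` (non-degeneracy of THE canonical cyclotomic `3`-adic height, ⟺ `[T¹]L_3 ≠ 0`). PUBLISHED
binders: Kato 17.4 (2) (`hK`), Perrin-Riou–Schneider at odd `p` (`hS`, BMS 2016 Thm. 1.7), Perrin-Riou
1987 §1.4 (`hPR`), Mazur–Tate σ (`hMT`), modularity (`hmodP`), GZK (`hGZK`), the period unit (`h3`); CELL
input `KatoMuTransferThree`; finite certificates `hcertA`, `hSch`. NO rational main conjecture, NO image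
hypothesis beyond `¬ Surj W 3`. Deduction: §1 datum into x10 GEN 6's
`X10.missingUpperBoundAt_three_rankOne_of_divisibility`, whose `hdiv` had no X10b source before.
[cite: Kato2004Asterisque, Thm. 17.4 (2) (p. 273)] [cite: PerrinRiou1987, §1.4 Cor. 1.8]
[cite: BalakrishnanMullerStein2015, Thm. 1.7] [cite: Miller2011LMS, Def. 1.1 (arXiv:1010.2431 p. 3)] -/
theorem missingUpperBoundAt_three_rankOne_of_katoMuTransferThree
    (hS : Schneider1985_order_charGenerator_odd) (hPR : perrinRiou_rankOne_leadingTerms_odd)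
    (hMT : mazur_tate_sigma_exists_odd) (hmodP : nonempty_modularParametrizationData)
    (hGZK : rank_eq_analyticRank_of_analyticRank_le_one)
    (h3 : realPeriodRat_eq_unit_mul_plusPeriod_three) (hT3 : KatoMuTransferThree)
    (hK : ∀ (κ : ZpExtension ℚ 3) (γ : Field.absoluteGaloisGroup ℚ) [NeZero (W.conductorNorm ℤ)]
      (f : CuspForm (Gamma0 (W.conductorNorm ℤ)) 2), kato_divisibility W 3 (κ := κ) (γ := γ) (f := f))
    (hX : ClassX10 W 3) (hns : ¬ Surj W 3) (hr1 : W.analyticRank = 1)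
    (hSch : ∀ Dh : PAdicHeightData W 3, Dh.IsCanonical → SchneiderConjecture Dh)
    (hcertA : ∀ {N : ℕ} [NeZero N] (f : CuspForm (Gamma0 N) 2), IsNewformOf W f →
      ∃ n : ℕ, ‖PowerSeries.coeff n (padicLFunction f (unitRoot W 3 : ℚ_[3]))‖ = 1) :
    Typed.MissingUpperBoundAt W 3 :=
  Summit.BirchSwinnertonDyer.BirchSwinnertonDyer.Theorems.Rank1ResidualX10bMainConjecture.X10.missingUpperBoundAt_three_rankOne_of_divisibility
    W hS hPR hMT hmodP hGZK hX hr1 hSch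
    (divisibility_three_of_katoMuTransferThree W hmodP h3 hT3 hK hX hns hcertA)

/-- **N2 ∩ {r = 1} at a pair with `ord₃ #Ш(E/ℚ)_an = 0`: `KatoMuTransferThree` ∧ certificates ⟹
Miller's `BSD(E,3)`** — the lower half is vacuous when the analytic order of `Ш` is a `3`-adic unit
(`hunit`, census datum), the upper half is `missingUpperBoundAt_three_rankOne_of_katoMuTransferThree`.
Every binder is a PUBLISHED named fact, the open node `KatoMuTransferThree`, or a finite per-pair
certificate (`hcertA`: unit coefficient; `hSch`: `[T¹]L_3 ≠ 0`; `hunit`: `3 ∤ #Ш_an`); no flag.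
Nothing booked (the census pairs are closed independently by unit x10b's exact `3`-descent).
[cite: Kato2004Asterisque, Thm. 17.4 (2) (p. 273)] [cite: PerrinRiou1987, §1.4 Cor. 1.8]
[cite: BalakrishnanMullerStein2015, Thm. 1.7] [cite: Miller2011LMS, Def. 1.1 (arXiv:1010.2431 p. 3)] -/
theorem bsdp_three_rankOne_of_katoMuTransferThree_of_shaAn_unit
    (hS : Schneider1985_order_charGenerator_odd) (hPR : perrinRiou_rankOne_leadingTerms_odd)
    (hMT : mazur_tate_sigma_exists_odd) (hmodP : nonempty_modularParametrizationData)
    (hGZK : rank_eq_analyticRank_of_analyticRank_le_one)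
    (h3 : realPeriodRat_eq_unit_mul_plusPeriod_three) (hT3 : KatoMuTransferThree)
    (hK : ∀ (κ : ZpExtension ℚ 3) (γ : Field.absoluteGaloisGroup ℚ) [NeZero (W.conductorNorm ℤ)]
      (f : CuspForm (Gamma0 (W.conductorNorm ℤ)) 2), kato_divisibility W 3 (κ := κ) (γ := γ) (f := f))
    (hX : ClassX10 W 3) (hns : ¬ Surj W 3) (hr1 : W.analyticRank = 1)
    (hSch : ∀ Dh : PAdicHeightData W 3, Dh.IsCanonical → SchneiderConjecture Dh)
    (hcertA : ∀ {N : ℕ} [NeZero N] (f : CuspForm (Gamma0 N) 2), IsNewformOf W f →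
      ∃ n : ℕ, ‖PowerSeries.coeff n (padicLFunction f (unitRoot W 3 : ℚ_[3]))‖ = 1)
    (hunit : ∃ q : ℚ, shaAn W = (q : ℂ) ∧ padicValRat 3 q = 0) : BSDp W 3 :=
  Summit.BirchSwinnertonDyer.BirchSwinnertonDyer.Theorems.Rank1ResidualX10bMainConjecture.X10.bsdp_three_rankOne_of_divisibility_of_shaAn_unit
    W hS hPR hMT hmodP hGZK hX hr1 hSch
    (divisibility_three_of_katoMuTransferThree W hmodP h3 hT3 hK hX hns hcertA) hunit

/-! ### §3. N2 ∩ {r = 0}: GEN 34's `μ`-zero road with `μ = 0` discharged by the transfer — flag-free -/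

/-- **N2 ∩ {r = 0}: `KatoMuTransferThree` ∧ certificate ⟹ the Euler-system half
`ord₃ #Ш(E/ℚ) ≤ ord₃ #Ш(E/ℚ)_an`** (`Typed.MissingUpperBoundAt W 3`). GEN 34's
`missingUpperBoundAt_three_of_greenbergMu` with its hypothesis `hμ` (Greenberg's Conj. 1.11 at the pair)
supplied by `x10b_mu_eq_zero_of_katoMuTransferThree`. PUBLISHED binders `hK` (Kato 17.4 (2)), `hS` +
`hMT` (Greenberg Thm. 4.1 at odd `p`), `hmodP`, `hGZK`, `h3`; CELL input `KatoMuTransferThree`; finite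
certificate `hcertA`. No rational main conjecture, no image hypothesis beyond `¬ Surj W 3`.
[cite: Kato2004Asterisque, Thm. 17.4 (2) (p. 273)] [cite: GreenbergLNM1716, §1 Conj. 1.11 and Thm. 4.1 (p. 102)]
[cite: Wuthrich2014, Prop. 21 (p. 400)] [cite: BalakrishnanMullerStein2015, Thm. 1.7] -/
theorem missingUpperBoundAt_three_rankZero_of_katoMuTransferThree
    (hS : Schneider1985_order_charGenerator_odd) (hMT : mazur_tate_sigma_exists_odd)
    (hmodP : nonempty_modularParametrizationData)
    (hGZK : rank_eq_analyticRank_of_analyticRank_le_one)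
    (h3 : realPeriodRat_eq_unit_mul_plusPeriod_three) (hT3 : KatoMuTransferThree)
    (hK : ∀ (κ : ZpExtension ℚ 3) (γ : Field.absoluteGaloisGroup ℚ) [NeZero (W.conductorNorm ℤ)]
      (f : CuspForm (Gamma0 (W.conductorNorm ℤ)) 2), kato_divisibility W 3 (κ := κ) (γ := γ) (f := f))
    (hX : ClassX10 W 3) (hns : ¬ Surj W 3) (hr0 : W.analyticRank = 0)
    (hcertA : ∀ {N : ℕ} [NeZero N] (f : CuspForm (Gamma0 N) 2), IsNewformOf W f →
      ∃ n : ℕ, ‖PowerSeries.coeff n (padicLFunction f (unitRoot W 3 : ℚ_[3]))‖ = 1) :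
    Typed.MissingUpperBoundAt W 3 :=
  missingUpperBoundAt_three_of_greenbergMu W hS hMT hmodP hGZK hK h3 hX hr0
    (x10b_mu_eq_zero_of_katoMuTransferThree hmodP hT3 W 3 hX hns hcertA)

/-- **N2 ∩ {r = 0}: under `KatoMuTransferThree` ∧ certificate, X_A3 at the pair ⟺ `BSD(E,3)`**:
`MazurMainConjecture W 3 ↔ BSDp W 3`. GEN 34's `mazurMainConjecture_iff_bsdp_three_of_greenbergMu` with
`hμ` discharged by the transfer. Binders as in `missingUpperBoundAt_three_rankZero_of_katoMuTransferThree`.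
[cite: Kato2004Asterisque, Thm. 17.4 (2) (p. 273)] [cite: GreenbergLNM1716, §1 Conj. 1.11, Thm. 4.1 and §5]
[cite: Miller2011LMS, Def. 1.1 (arXiv:1010.2431 p. 3)] -/
theorem mazurMainConjecture_iff_bsdp_three_rankZero_of_katoMuTransferThree
    (hS : Schneider1985_order_charGenerator_odd) (hMT : mazur_tate_sigma_exists_odd)
    (hmodP : nonempty_modularParametrizationData)
    (hGZK : rank_eq_analyticRank_of_analyticRank_le_one)
    (h3 : realPeriodRat_eq_unit_mul_plusPeriod_three) (hT3 : KatoMuTransferThree)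
    (hK : ∀ (κ : ZpExtension ℚ 3) (γ : Field.absoluteGaloisGroup ℚ) [NeZero (W.conductorNorm ℤ)]
      (f : CuspForm (Gamma0 (W.conductorNorm ℤ)) 2), kato_divisibility W 3 (κ := κ) (γ := γ) (f := f))
    (hX : ClassX10 W 3) (hns : ¬ Surj W 3) (hr0 : W.analyticRank = 0)
    (hcertA : ∀ {N : ℕ} [NeZero N] (f : CuspForm (Gamma0 N) 2), IsNewformOf W f →
      ∃ n : ℕ, ‖PowerSeries.coeff n (padicLFunction f (unitRoot W 3 : ℚ_[3]))‖ = 1) :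
    MazurMainConjecture W 3 ↔ BSDp W 3 :=
  mazurMainConjecture_iff_bsdp_three_of_greenbergMu W hS hMT hmodP hGZK hK h3 hX hr0
    (x10b_mu_eq_zero_of_katoMuTransferThree hmodP hT3 W 3 hX hns hcertA)

/-- **N2 ∩ {r = 0}, the road to X_A3 AT THE PAIR: `KatoMuTransferThree` ∧ certificate ∧ `BSDp W 3` ⟹
`MazurMainConjecture W 3`.** At every rank-`0` N2 pair whose `BSD(E,3)` is booked by the lane's
certificates (two-engine exact `3`-descent / Heegner index, R146.1 / R171.3), the typed missing input
X_A3 at the pair follows from the open node `KatoMuTransferThree` and the `μ^an = 0` certificate alone —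
no rational main conjecture, no flag. GEN 34's `mazurMainConjecture_three_of_greenbergMu_of_bsdp` with
`hμ` discharged by the transfer. Nothing booked; the class label does not move.
[cite: Kato2004Asterisque, Thm. 17.4 (2) (p. 273)] [cite: GreenbergLNM1716, §1 Conj. 1.11 and §5]
[cite: Miller2011LMS, Def. 1.1 (arXiv:1010.2431 p. 3)] -/
theorem mazurMainConjecture_three_rankZero_of_katoMuTransferThree_of_bsdp
    (hS : Schneider1985_order_charGenerator_odd) (hMT : mazur_tate_sigma_exists_odd)
    (hmodP : nonempty_modularParametrizationData)
    (hGZK : rank_eq_analyticRank_of_analyticRank_le_one)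
    (h3 : realPeriodRat_eq_unit_mul_plusPeriod_three) (hT3 : KatoMuTransferThree)
    (hK : ∀ (κ : ZpExtension ℚ 3) (γ : Field.absoluteGaloisGroup ℚ) [NeZero (W.conductorNorm ℤ)]
      (f : CuspForm (Gamma0 (W.conductorNorm ℤ)) 2), kato_divisibility W 3 (κ := κ) (γ := γ) (f := f))
    (hX : ClassX10 W 3) (hns : ¬ Surj W 3) (hr0 : W.analyticRank = 0)
    (hcertA : ∀ {N : ℕ} [NeZero N] (f : CuspForm (Gamma0 N) 2), IsNewformOf W f →
      ∃ n : ℕ, ‖PowerSeries.coeff n (padicLFunction f (unitRoot W 3 : ℚ_[3]))‖ = 1)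
    (hbsd : BSDp W 3) : MazurMainConjecture W 3 :=
  mazurMainConjecture_three_of_greenbergMu_of_bsdp W hS hMT hmodP hGZK hK h3 hX hr0
    (x10b_mu_eq_zero_of_katoMuTransferThree hmodP hT3 W 3 hX hns hcertA) hbsd

/-! ### §4. ALL of class X10 ∩ {r = 0} (EITHER image): the transfer road and the X10a′ tower road together -/

/-- **Class X10 ∩ {r = 0}, EITHER mod-`3` image: `KatoMuTransferThree` ∧ certificate ⟹ the Euler-system
half `ord₃ #Ш(E/ℚ) ≤ ord₃ #Ш(E/ℚ)_an`** — NO image hypothesis at all. If `ρ̄_{E,3}` is surjective, the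
good-ordinary tower (`X10.towerSurj_of_surj`, Wuthrich's Lemma 20 as a tree theorem) gives Kato's
(12.5.2) and x10 GEN 5's `missingUpperBoundAt_of_kato_of_surjective_pow` applies (the certificate is not
even needed); if not, §3. PUBLISHED binders `hK`, `hS` + `hMT`, `hmodP`, `hGZK`, `h3`; CELL input
`KatoMuTransferThree`; finite certificate `hcertA`. [cite: Kato2004Asterisque, Thm. 17.4 (2), (3) (p. 273)]
[cite: Wuthrich2014, Lemma 20 (p. 399) and Prop. 21 (p. 400)] [cite: GreenbergLNM1716, §1 Conj. 1.11 and Thm. 4.1 (p. 102)] -/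
theorem missingUpperBoundAt_three_rankZero_of_katoMuTransferThree_anyImage
    (hS : Schneider1985_order_charGenerator_odd) (hMT : mazur_tate_sigma_exists_odd)
    (hmodP : nonempty_modularParametrizationData)
    (hGZK : rank_eq_analyticRank_of_analyticRank_le_one)
    (h3 : realPeriodRat_eq_unit_mul_plusPeriod_three) (hT3 : KatoMuTransferThree)
    (hK : ∀ (κ : ZpExtension ℚ 3) (γ : Field.absoluteGaloisGroup ℚ) [NeZero (W.conductorNorm ℤ)]
      (f : CuspForm (Gamma0 (W.conductorNorm ℤ)) 2), kato_divisibility W 3 (κ := κ) (γ := γ) (f := f))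
    (hX : ClassX10 W 3) (hr0 : W.analyticRank = 0)
    (hcertA : ∀ {N : ℕ} [NeZero N] (f : CuspForm (Gamma0 N) 2), IsNewformOf W f →
      ∃ n : ℕ, ‖PowerSeries.coeff n (padicLFunction f (unitRoot W 3 : ℚ_[3]))‖ = 1) :
    Typed.MissingUpperBoundAt W 3 := by
  by_cases hsurj : Surj W 3
  · haveI : NeZero (W.conductorNorm ℤ) := ⟨(W.conductorNorm_pos_holds).ne'⟩
    obtain ⟨Dm⟩ := hmodP W
    have hL : W.entireLFunction 1 ≠ 0 :=
      (W.analyticRank_eq_zero_iff_holds Dm.isNewformOf.hasEntireLFunction).mp hr0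
    exact missingUpperBoundAt_of_kato_of_surjective_pow W 3
      (greenberg_charValue_rankZero_of_Schneider1985_odd hS hMT) hmodP hGZK hK (by decide) hX.2.1.1
      hX.2.1.2 (Literature.NumberTheory.EllipticCurves.Rank1Residual.X10.towerSurj_of_surj W hX hsurj) hL
      (fun f hf ϖ hϖeq ↦ padicValRat_periodRatio_eq_zero_three W h3 hX.2.1.1 hX.2.2.1 f hf ϖ hϖeq)
  · exact missingUpperBoundAt_three_rankZero_of_katoMuTransferThree W hS hMT hmodP hGZK h3 hT3 hK hX
      hsurj hr0 hcertA

/-- **Class X10 ∩ {r = 0}, EITHER mod-`3` image: under `KatoMuTransferThree` ∧ certificate,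
`MazurMainConjecture W 3 ↔ BSDp W 3`** — NO image hypothesis. Surjective image: x10 GEN 13's
`mazurMainConjecture_iff_bsdp_three_of_towerSurj` (Kato (3) on the tower); otherwise §3. So on the whole
of class X10 at rank `0` the open node `KatoMuTransferThree` (+ the finite `μ^an = 0` certificate) makes
the typed missing input `MazurMainConjecture W 3` EQUIVALENT to Miller's `BSD(E,3)` — per pair, X_A3 at
the pair ⟸ the booked `BSD(E,3)`. Binders as above. [cite: Kato2004Asterisque, Thm. 17.4 (2), (3) (p. 273)]
[cite: Wuthrich2014, Lemma 20 (p. 399)] [cite: GreenbergLNM1716, §1 Conj. 1.11, Thm. 4.1 and §5]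
[cite: Miller2011LMS, Def. 1.1 (arXiv:1010.2431 p. 3)] -/
theorem mazurMainConjecture_iff_bsdp_three_rankZero_of_katoMuTransferThree_anyImage
    (hS : Schneider1985_order_charGenerator_odd) (hMT : mazur_tate_sigma_exists_odd)
    (hmodP : nonempty_modularParametrizationData)
    (hGZK : rank_eq_analyticRank_of_analyticRank_le_one)
    (h3 : realPeriodRat_eq_unit_mul_plusPeriod_three) (hT3 : KatoMuTransferThree)
    (hK : ∀ (κ : ZpExtension ℚ 3) (γ : Field.absoluteGaloisGroup ℚ) [NeZero (W.conductorNorm ℤ)]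
      (f : CuspForm (Gamma0 (W.conductorNorm ℤ)) 2), kato_divisibility W 3 (κ := κ) (γ := γ) (f := f))
    (hX : ClassX10 W 3) (hr0 : W.analyticRank = 0)
    (hcertA : ∀ {N : ℕ} [NeZero N] (f : CuspForm (Gamma0 N) 2), IsNewformOf W f →
      ∃ n : ℕ, ‖PowerSeries.coeff n (padicLFunction f (unitRoot W 3 : ℚ_[3]))‖ = 1) :
    MazurMainConjecture W 3 ↔ BSDp W 3 := by
  by_cases hsurj : Surj W 3
  · exact mazurMainConjecture_iff_bsdp_three_of_towerSurj W hS hMT hmodP hGZK hK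
      (fun f hf ϖ hϖeq ↦ padicValRat_periodRatio_eq_zero_three W h3 hX.2.1.1 hX.2.2.1 f hf ϖ hϖeq)
      hX hsurj hr0
  · exact mazurMainConjecture_iff_bsdp_three_rankZero_of_katoMuTransferThree W hS hMT hmodP hGZK h3
      hT3 hK hX hsurj hr0 hcertA

end Summit.BirchSwinnertonDyer.Rank1Residual.X10

end
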